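import Literature.RingTheory.FormalGroups.FormalOModuleBudLinearization
import Literature.RingTheory.FormalGroups.LawOfLogarithm
import HarnessLib

/-!
# Buds of formal `𝒪`-module laws, X: transport of the additive law and EXTENSION of buds over `𝒪`-algebras with `ϖ` invertible
# ([Drinfeld 1974] §1 Prop. 1.2; [Hazewinkel 1978] §21.5; [Lazard 1955] §II)

Topic `Literature/RingTheory/FormalGroups`; namespace `Literature.RingTheory.FormalGroups`.  One definition (`transportedLaw`: the
formal `𝒪`-module law `(h⁻¹(h(X₀)+h(X₁)), a ↦ h⁻¹(a·h(X)))` attached to a strict series `h`) + fully proved theorems; no named fact,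
no instance, no notation, no `sorry`.  Cell `hodgecm-mathlib`, P6 «MOD programme», sub-line P6d (power-series layer for
`stub_L4B3cO`).

* `transportedLaw 𝒪 hs h0 h1 : FormalOModuleLaw 𝒪 R` — the additive formal `𝒪`-module TRANSPORTED along the strict series `hs`
  (law ★ `FormalGroup.ofLogarithm hs`, action `[a](X) = hs⁻¹(a·hs(X))`), with `hs ∘ [a] = a·hs`.
* `IsOModuleBud.exists_extend_of_units` — EXTENSION: over an `𝒪`-algebra `R` in which `ϖ^i − ϖ` (`i ≥ 2`) are units, every
  `k`-bud (`k ≥ 1`) is congruent `mod deg k+1` to an exact formal `𝒪`-module law (the transported law along the linearising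
  series of the sibling `FormalOModuleBudLinearization`), in particular extends to a `(k+1)`-bud.
-/

noncomputable section

namespace Literature.RingTheory.FormalGroups

open MvPowerSeries (HasSubst subst X order coeff)

universe u v

variable (𝒪 : Type u) [CommRing 𝒪] {R : Type v} [CommRing R] [Algebra 𝒪 R]

/-! ## §1 The transported additive law -/

section Transport

variable (hs : PowerSeries R) (h0 : PowerSeries.constantCoeff hs = 0) (h1 : PowerSeries.coeff 1 hs = 1)

/-- The series `hs⁻¹(c·hs(X))`. [cite: Hazewinkel1978, §21.5] -/
private def actSeries (c : R) : PowerSeries R := PowerSeries.subst (c • hs) (logInv hs h1)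

include h0 in
/-- `c·hs` is substitutable. [folklore] -/
private theorem hasSubst_smul (c : R) : PowerSeries.HasSubst (c • hs) :=
  PowerSeries.HasSubst.of_constantCoeff_zero' (by rw [PowerSeries.smul_eq_C_mul, map_mul, h0, mul_zero])

include h0 in
/-- `hs(hs⁻¹(c·hs)) = c·hs`. [cite: Hazewinkel1978, §21.5] -/
private theorem subst_actSeries (c : R) : PowerSeries.subst (actSeries hs h1 c) hs = c • hs := by
  rw [actSeries, ← PowerSeries.subst_comp_subst_apply (PowerSeries.HasSubst.of_constantCoeff_zero' (constantCoeff_logInv hs h1))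
    (hasSubst_smul hs h0 c), subst_logInv hs h1 h0, PowerSeries.subst_X (hasSubst_smul hs h0 c)]

include h0 in
/-- `hs⁻¹(c·hs)` has no constant term. [folklore] -/
private theorem constantCoeff_actSeries (c : R) : PowerSeries.constantCoeff (actSeries hs h1 c) = 0 :=
  PowerSeries.constantCoeff_subst_eq_zero
    (by change PowerSeries.constantCoeff (c • hs) = 0; rw [PowerSeries.smul_eq_C_mul, map_mul, h0, mul_zero]) _
    (constantCoeff_logInv hs h1)

include h0 in
/-- `hs⁻¹(u)` evaluated through a further substitution: `(hs⁻¹(c·hs))(v) = hs⁻¹(c·hs(v))`. [folklore] -/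
private theorem actSeries_subst {τ : Type*} (c : R) {v : MvPowerSeries τ R} (hv : MvPowerSeries.constantCoeff v = 0) :
    PowerSeries.subst v (actSeries hs h1 c) = PowerSeries.subst (c • PowerSeries.subst v hs) (logInv hs h1) := by
  rw [actSeries, PowerSeries.subst_comp_subst_apply (hasSubst_smul hs h0 c) (PowerSeries.HasSubst.of_constantCoeff_zero hv),
    PowerSeries.subst_smul (PowerSeries.HasSubst.of_constantCoeff_zero hv)]

include h0 in
/-- The endomorphism `[c](X) = hs⁻¹(c·hs(X))` of the law `hs⁻¹(hs(X₀)+hs(X₁))`. [cite: Hazewinkel1978, §21.5] -/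
private def actHom (c : R) : FormalGroupHom (FormalGroup.ofLogarithm hs h1 h0) (FormalGroup.ofLogarithm hs h1 h0) where
  toPowerSeries := actSeries hs h1 c
  constantCoeff_eq_zero := constantCoeff_actSeries hs h0 h1 c
  map_add := by
    have hF := hasSubst_formalGroup (FormalGroup.ofLogarithm hs h1 h0)
    have hX : ∀ i : Fin 2, MvPowerSeries.constantCoeff (X i : MvPowerSeries (Fin 2) R) = 0 := fun i =>
      MvPowerSeries.constantCoeff_X i
    have hw : ∀ i : Fin 2, MvPowerSeries.constantCoeff (PowerSeries.subst (X i : MvPowerSeries (Fin 2) R) (actSeries hs h1 c)) = 0 :=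
      fun i => PowerSeries.constantCoeff_subst_eq_zero (hX i) _ (constantCoeff_actSeries hs h0 h1 c)
    have hvec : ∀ i, MvPowerSeries.constantCoeff ((![PowerSeries.subst (X 0 : MvPowerSeries (Fin 2) R) (actSeries hs h1 c),
        PowerSeries.subst (X 1) (actSeries hs h1 c)] : Fin 2 → MvPowerSeries (Fin 2) R) i) = 0 := fun i => by
      fin_cases i <;> simp [hw]
    change PowerSeries.subst (logLawSeries hs h1) (actSeries hs h1 c) = subst _ (logLawSeries hs h1)
    rw [actSeries_subst hs h0 h1 c (v := logLawSeries hs h1) (FormalGroup.ofLogarithm hs h1 h0).zero_constantCoeff]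
    have hlog := log_subst_logLawSeries hs h1 h0 (a := (X : Fin 2 → MvPowerSeries (Fin 2) R))
      (fun i => MvPowerSeries.constantCoeff_X i)
    rw [MvPowerSeries.subst_self, id] at hlog
    change PowerSeries.subst (c • PowerSeries.subst (logLawSeries hs h1) hs) _ = _
    rw [hlog, logLawSeries_subst hs h1 h0 hvec]
    simp only [Matrix.cons_val_zero, Matrix.cons_val_one, smul_add]
    congr 2
    · rw [actSeries_subst hs h0 h1 c (hX 0), ← PowerSeries.subst_comp_subst_apply
        (PowerSeries.HasSubst.of_constantCoeff_zero' (constantCoeff_logInv hs h1))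
        (PowerSeries.HasSubst.of_constantCoeff_zero (by simp [PowerSeries.constantCoeff_subst_eq_zero (hX 0) hs h0])),
        subst_logInv hs h1 h0, PowerSeries.subst_X
        (PowerSeries.HasSubst.of_constantCoeff_zero (by simp [PowerSeries.constantCoeff_subst_eq_zero (hX 0) hs h0]))]
    · rw [actSeries_subst hs h0 h1 c (hX 1), ← PowerSeries.subst_comp_subst_apply
        (PowerSeries.HasSubst.of_constantCoeff_zero' (constantCoeff_logInv hs h1))
        (PowerSeries.HasSubst.of_constantCoeff_zero (by simp [PowerSeries.constantCoeff_subst_eq_zero (hX 1) hs h0])),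
        subst_logInv hs h1 h0, PowerSeries.subst_X
        (PowerSeries.HasSubst.of_constantCoeff_zero (by simp [PowerSeries.constantCoeff_subst_eq_zero (hX 1) hs h0]))]

include h0 h1 in
/-- **The transported additive formal `𝒪`-module law** along a strict series `hs`: law `hs⁻¹(hs(X₀) + hs(X₁))`, action
`[a](X) = hs⁻¹(a·hs(X))`. [cite: Hazewinkel1978, §21.5] [cite: Drinfeld1974, §1 Prop. 1.2 (proof)] -/
def transportedLaw : FormalOModuleLaw 𝒪 R where
  toFormalGroup := FormalGroup.ofLogarithm hs h1 h0
  isComm := FormalGroup.ofLogarithm_isComm hs h1 h0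
  act a := actHom hs h0 h1 (algebraMap 𝒪 R a)
  coeff_one_act a := by
    change PowerSeries.coeff 1 (actSeries hs h1 (algebraMap 𝒪 R a)) = algebraMap 𝒪 R a
    -- `hs⁻¹(u) ≡ u (mod deg 2)` and `u = a·hs ≡ a·X (mod deg 2)`
    have hu0 : MvPowerSeries.constantCoeff ((algebraMap 𝒪 R a • hs : PowerSeries R) : MvPowerSeries Unit R) = 0 := by
      change PowerSeries.constantCoeff (algebraMap 𝒪 R a • hs) = 0; simp [h0]
    have e1 := le_order_psubst_sub_psubst_sub (constantCoeff_logInv hs h1) (coeff_one_logInv hs h1) le_rfl hu0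
      MvPowerSeries.constantCoeff_zero (by simpa using one_le_order_of_constantCoeff hu0)
    rw [PowerSeries.subst_zero_of_constantCoeff_zero (constantCoeff_logInv hs h1), sub_zero, sub_zero] at e1
    have e2 := (natCast_le_order_sub_iff.1 e1) (Finsupp.single () 1) (by simp)
    rw [← PowerSeries.coeff_def (s := Finsupp.single () 1) (n := 1) (by simp)] at e2
    change PowerSeries.coeff 1 (actSeries hs h1 _) = PowerSeries.coeff 1 (algebraMap 𝒪 R a • hs) at e2
    rw [e2, map_smul, h1, smul_eq_mul, mul_one]
  act_zero := by
    change actSeries hs h1 (algebraMap 𝒪 R 0) = 0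
    rw [actSeries, map_zero, zero_smul, PowerSeries.subst_zero_of_constantCoeff_zero (constantCoeff_logInv hs h1)]
  act_one := by
    change actSeries hs h1 (algebraMap 𝒪 R 1) = PowerSeries.X
    rw [actSeries, map_one, one_smul, logInv_subst hs h1 h0]
  act_add a b := by
    change actSeries hs h1 (algebraMap 𝒪 R (a + b)) =
      (logLawSeries hs h1).subst ![(actSeries hs h1 (algebraMap 𝒪 R a) : MvPowerSeries Unit R), actSeries hs h1 (algebraMap 𝒪 R b)]
    have hvec : ∀ i, MvPowerSeries.constantCoeff ((![(actSeries hs h1 (algebraMap 𝒪 R a) : MvPowerSeries Unit R),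
        actSeries hs h1 (algebraMap 𝒪 R b)] : Fin 2 → MvPowerSeries Unit R) i) = 0 := fun i => by
      fin_cases i <;> exact constantCoeff_actSeries hs h0 h1 _
    rw [logLawSeries_subst hs h1 h0 hvec]
    simp only [Matrix.cons_val_zero, Matrix.cons_val_one]
    rw [subst_actSeries hs h0 h1, subst_actSeries hs h0 h1, actSeries, map_add, add_smul]
  act_mul a b := by
    change actSeries hs h1 (algebraMap 𝒪 R (a * b)) = PowerSeries.subst (actSeries hs h1 (algebraMap 𝒪 R b)) (actSeries hs h1 _)
    rw [actSeries_subst hs h0 h1 _ (constantCoeff_actSeries hs h0 h1 _), subst_actSeries hs h0 h1, actSeries, map_mul,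
      smul_smul]

/-- The law of `transportedLaw` is `hs⁻¹(hs(X₀)+hs(X₁))`. [cite: Hazewinkel1978, §21.5] -/
theorem transportedLaw_toPowerSeries :
    (transportedLaw 𝒪 hs h0 h1).toFormalGroup.toPowerSeries = logLawSeries hs h1 := rfl

include h0 in
/-- **`hs` conjugates the action into multiplication**: `hs([a](X)) = a·hs(X)`. [cite: Hazewinkel1978, §21.5] -/
theorem subst_transportedLaw_act (a : 𝒪) :
    PowerSeries.subst ((transportedLaw 𝒪 hs h0 h1).act a).toPowerSeries hs = algebraMap 𝒪 R a • hs :=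
  subst_actSeries hs h0 h1 _

/-- `hs` is the logarithm of the transported law: `hs(F(X₀,X₁)) = hs(X₀) + hs(X₁)`. [cite: Hazewinkel1978, §21.5] -/
theorem subst_transportedLaw_law :
    PowerSeries.subst (transportedLaw 𝒪 hs h0 h1).toFormalGroup.toPowerSeries hs =
      PowerSeries.subst (X 0 : MvPowerSeries (Fin 2) R) hs + PowerSeries.subst (X 1 : MvPowerSeries (Fin 2) R) hs := by
  have h := log_subst_logLawSeries hs h1 h0 (a := (X : Fin 2 → MvPowerSeries (Fin 2) R)) (fun i => MvPowerSeries.constantCoeff_X i)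
  rwa [MvPowerSeries.subst_self] at h

end Transport

/-! ## §2 Extension of buds -/

variable {𝒪}

/-- **Extension over an `𝒪`-algebra in which the `ϖ^i − ϖ` (`i ≥ 2`) are units.**  A `k`-bud `(f, r)` (`k ≥ 1`) over such an
`R` is congruent `mod deg k+1` to an EXACT formal `𝒪`-module law `M` (the additive law transported along the linearising series
of `r_ϖ`); in particular it extends to buds of every order. [cite: Drinfeld1974, §1 Prop. 1.2 (proof)] [cite: Hazewinkel1978, §21.5] -/
theorem IsOModuleBud.exists_formalOModuleLaw_congr {k : ℕ} {f : MvPowerSeries (Fin 2) R} {r : 𝒪 → PowerSeries R}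
    (h : IsOModuleBud 𝒪 k f r) (hk : 1 ≤ k) (ϖ : 𝒪)
    (hc : ∀ i : ℕ, 2 ≤ i → IsUnit (algebraMap 𝒪 R ϖ ^ i - algebraMap 𝒪 R ϖ)) :
    ∃ M : FormalOModuleLaw 𝒪 R, ((k + 1 : ℕ) : ℕ∞) ≤ (M.toFormalGroup.toPowerSeries - f).order ∧
      ∀ a, ((k + 1 : ℕ) : ℕ∞) ≤ MvPowerSeries.order ((M.act a).toPowerSeries - r a) := by
  obtain ⟨hs, h0, h1, hlin⟩ := h.exists_linearizer hk ϖ hc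
  refine ⟨transportedLaw 𝒪 hs h0 h1, ?_, fun a => ?_⟩
  · refine le_order_sub_of_log_subst hs h1 h0 (transportedLaw 𝒪 hs h0 h1).toFormalGroup.zero_constantCoeff h.constantCoeff_F ?_
    rw [subst_transportedLaw_law]
    have := h.le_order_linearizer_law hc h0 h1 hlin
    rw [sub_sub] at this
    exact natCast_le_order_sub_comm this
  · refine le_order_sub_of_log_subst hs h1 h0 (τ := Unit) ((transportedLaw 𝒪 hs h0 h1).act a).constantCoeff_eq_zero
      (h.constantCoeff_ρ a) ?_
    rw [subst_transportedLaw_act]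
    exact natCast_le_order_sub_comm (h.le_order_linearizer_act hc h0 h1 hlin a)

/-- **Corollary: `k`-buds extend to `(k+1)`-buds** over such `R`. [cite: Drinfeld1974, §1 Prop. 1.2 (proof)] -/
theorem IsOModuleBud.exists_extend_of_units {k : ℕ} {f : MvPowerSeries (Fin 2) R} {r : 𝒪 → PowerSeries R}
    (h : IsOModuleBud 𝒪 k f r) (hk : 1 ≤ k) (ϖ : 𝒪)
    (hc : ∀ i : ℕ, 2 ≤ i → IsUnit (algebraMap 𝒪 R ϖ ^ i - algebraMap 𝒪 R ϖ)) :
    ∃ (F : MvPowerSeries (Fin 2) R) (ρ : 𝒪 → PowerSeries R), IsOModuleBud 𝒪 (k + 1) F ρ ∧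
      ((k + 1 : ℕ) : ℕ∞) ≤ (F - f).order ∧ ∀ a, ((k + 1 : ℕ) : ℕ∞) ≤ MvPowerSeries.order (ρ a - r a) := by
  obtain ⟨M, hF, hρ⟩ := h.exists_formalOModuleLaw_congr hk ϖ hc
  exact ⟨_, _, M.isOModuleBud (k + 1), hF, hρ⟩

end Literature.RingTheory.FormalGroups
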